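import Summits.Ventures.DiscreteObjects.PP12.OrderElevenTriangleKernel
import Summits.Ventures.DiscreteObjects.PP12.OrderElevenTriangleTableA
import Summits.Ventures.DiscreteObjects.PP12.OrderElevenTriangleRowsA
import Summits.Ventures.DiscreteObjects.PP12.OrderElevenTriangleRowsB

/-!
# PP(12), order-11 cell, Case B (`NoTriangleData12`): kernel RUNS — walker equations, part B (designs g23)
Framing: lottery ticket; floor = certified bounds/negative ranges.

Cell pub-namedobj (venture DiscreteObjects), target (M). The partition walker reproduces the literal table `PARTS` and the label walker reproduces the literal candidate-row tables `ROWSk` of the orbit representatives `REPS[k]` (this part: `k = 3, 4, 5, 6`).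
Every declaration is closed by `decide +kernel` (kernel shape measured by designs g23: a row walk ≈ 40 s, a scan slice ≤ 5 s, a φ-walk slice ≈ 3 s).
Exact Python mirror of every function and table: pub-namedobj-designs-g23/code/caseB/tri12k.py (all statements below are `True` there too).
No `sorry`, no axioms beyond the standard three; nothing here asserts a census statement by itself.
-/

namespace Summit.Ventures.DiscreteObjects.PP12

namespace Triangle12

set_option maxHeartbeats 400000000 in
/-- the candidate rows of representative `3` (`φ = 0x12357496a80`, 182 rows) are exactly `ROWS3` -/
theorem rows_eq_3 : rowsFrom 0x12357496a80 PARTS = ROWS3 := by decide +kernel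

set_option maxHeartbeats 400000000 in
/-- the candidate rows of representative `4` (`φ = 0x123456789a0`, 88 rows) are exactly `ROWS4` -/
theorem rows_eq_4 : rowsFrom 0x123456789a0 PARTS = ROWS4 := by decide +kernel

set_option maxHeartbeats 400000000 in
/-- the candidate rows of representative `5` (`φ = 0x12469358a70`, 126 rows) are exactly `ROWS5` -/
theorem rows_eq_5 : rowsFrom 0x12469358a70 PARTS = ROWS5 := by decide +kernel

set_option maxHeartbeats 400000000 in
/-- the candidate rows of representative `6` (`φ = 0x124673a8590`, 138 rows) are exactly `ROWS6` -/
theorem rows_eq_6 : rowsFrom 0x124673a8590 PARTS = ROWS6 := by decide +kernel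

end Triangle12

end Summit.Ventures.DiscreteObjects.PP12
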